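import Summits.CriticalPhenomena.PercolationContinuityZ3.Theorems.SahiLiebSahiContinuumReal

/-!
# The distribution function of an atomless law and the extended quantile transform (preliminaries)

Support file of the Sahi cell (`prim-sahi`, typer seat, generation 21; `--supports stmt-CriticalPhenomena-4575`).
Tools for `SahiAEVersionTransport.lean` (transport of Borel everywhere-MTP₂ versions from Lebesgue measure to products
of atomless measures):

* `continuous_cdf_of_nullSingletonClass` — the distribution function of an ATOMLESS probability measure on `ℝ` is
  continuous (`StieltjesFunction.measure_singleton`: the jump at `a` is the mass of `{a}`);
* `cdf_rq_eq` — hence `cdf (quantile u) = u` for EVERY `u ∈ (0,1)` (the quantile `RealQuantile.rq` of the tree);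
* `rqe μ` — the quantile transform extended by `0` off `(0,1)`, a total measurable map `ℝ → ℝ`, monotone on `(0,1)`
  (`measurable_rqe`, `monotoneOn_rqe`), pushing `λ|_{(0,1)}` to `μ` (`map_rqe_volume_restrict`,
  `measurePreserving_rqe`; companion of `RealQuantile.map_rqI_volume`, which is stated on the subtype `[0,1]`).

No sorries, no new axioms.
-/

noncomputable section

namespace Summit.CriticalPhenomena.PercolationContinuityZ3.Theorems.SahiAEFourFunctions

open MeasureTheory Set Filter Topology ProbabilityTheory RealQuantile
open scoped ENNReal NNReal

/-- The distribution function of an ATOMLESS probability measure on `ℝ` is continuous. [folklore] -/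
theorem continuous_cdf_of_nullSingletonClass (μ : Measure ℝ) [IsProbabilityMeasure μ] [NullSingletonClass μ] : Continuous (cdf μ) := by
  refine continuous_iff_continuousAt.2 fun a => ?_
  rw [(monotone_cdf μ).continuousAt_iff_leftLim_eq_rightLim, (cdf μ).rightLim_eq]
  refine le_antisymm ((monotone_cdf μ).leftLim_le le_rfl) ?_
  have h := (cdf μ).measure_singleton a
  rw [measure_cdf, measure_singleton] at h
  have h' : cdf μ a - Function.leftLim (cdf μ) a ≤ 0 := by
    by_contra hlt
    exact (ENNReal.ofReal_pos.2 (not_le.1 hlt)).ne' h.symm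
  linarith

/-- For an atomless law, `cdf (quantile u) = u` for every `u ∈ (0,1)`. [folklore] -/
theorem cdf_rq_eq (μ : Measure ℝ) [IsProbabilityMeasure μ] [NullSingletonClass μ] {u : ℝ} (hu : u ∈ Ioo (0 : ℝ) 1) :
    cdf μ (rq μ u) = u := by
  refine le_antisymm ?_ (le_cdf_rq μ hu.2)
  by_contra hlt
  push Not at hlt
  have hev : ∀ᶠ s in 𝓝 (rq μ u), u < cdf μ s :=
    ((continuous_cdf_of_nullSingletonClass μ).tendsto (rq μ u)).eventually (lt_mem_nhds hlt)
  obtain ⟨s, hs, hsq⟩ := ((hev.filter_mono nhdsWithin_le_nhds : ∀ᶠ s in 𝓝[<] (rq μ u), u < cdf μ s).and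
    (eventually_mem_nhdsWithin : ∀ᶠ s in 𝓝[<] (rq μ u), s ∈ Iio (rq μ u))).exists
  have : rq μ u ≤ s := csInf_le (bddBelow_qSet μ hu.1) ((mem_qSet μ).2 hs.le)
  exact (lt_irrefl _) (this.trans_lt hsq)

/-- The quantile transform extended by `0` off `(0,1)` (a total measurable function `ℝ → ℝ`). [folklore] -/
def rqe (μ : Measure ℝ) (u : ℝ) : ℝ := if u ∈ Ioo (0 : ℝ) 1 then rq μ u else 0

/-- `rqe = rq` on `(0,1)`. [folklore] -/
theorem rqe_of_mem (μ : Measure ℝ) {u : ℝ} (hu : u ∈ Ioo (0 : ℝ) 1) : rqe μ u = rq μ u := if_pos hu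

/-- Sublevel sets of `rqe`. [folklore] -/
theorem rqe_preimage_Iic (μ : Measure ℝ) (t : ℝ) :
    rqe μ ⁻¹' Iic t = (Ioo (0 : ℝ) 1 ∩ {u | u ≤ cdf μ t}) ∪ ((Ioo (0 : ℝ) 1)ᶜ ∩ {_u | (0 : ℝ) ≤ t}) := by
  ext u
  simp only [Set.mem_preimage, Set.mem_Iic, Set.mem_union, Set.mem_inter_iff, Set.mem_setOf_eq, Set.mem_compl_iff]
  by_cases hu : u ∈ Ioo (0 : ℝ) 1
  · rw [rqe_of_mem μ hu, rq_le_iff μ hu.1 hu.2]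
    exact ⟨fun h => Or.inl ⟨hu, h⟩, fun h => h.elim (fun h => h.2) fun h => (h.1 hu).elim⟩
  · rw [rqe, if_neg hu]
    exact ⟨fun h => Or.inr ⟨hu, h⟩, fun h => h.elim (fun h => (hu h.1).elim) fun h => h.2⟩

/-- `rqe` is measurable. [folklore] -/
theorem measurable_rqe (μ : Measure ℝ) : Measurable (rqe μ) := by
  refine measurable_of_Iic fun t => ?_
  rw [rqe_preimage_Iic]
  exact (measurableSet_Ioo.inter (measurableSet_le measurable_id measurable_const)).union
    (measurableSet_Ioo.compl.inter (MeasurableSet.const _))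

/-- `rqe` is monotone on `(0,1)`. [folklore] -/
theorem monotoneOn_rqe (μ : Measure ℝ) : MonotoneOn (rqe μ) (Ioo (0 : ℝ) 1) := by
  intro u hu v hv huv
  rw [rqe_of_mem μ hu, rqe_of_mem μ hv]
  exact rq_mono μ hu.1 huv hv.2

/-- **The extended quantile transform pushes `λ|_{(0,1)}` to `μ`.** [folklore] -/
theorem map_rqe_volume_restrict (μ : Measure ℝ) [IsProbabilityMeasure μ] :
    ((volume : Measure ℝ).restrict (Ioo (0 : ℝ) 1)).map (rqe μ) = μ := by
  haveI : IsFiniteMeasure ((volume : Measure ℝ).restrict (Ioo (0 : ℝ) 1)) :=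
    ⟨by rw [Measure.restrict_apply_univ, Real.volume_Ioo]; exact ENNReal.ofReal_lt_top⟩
  refine Measure.ext_of_Iic _ μ fun t => ?_
  rw [Measure.map_apply (measurable_rqe μ) measurableSet_Iic, Measure.restrict_apply' measurableSet_Ioo,
    rqe_preimage_Iic]
  have hset : ((Ioo (0 : ℝ) 1 ∩ {u | u ≤ cdf μ t}) ∪ ((Ioo (0 : ℝ) 1)ᶜ ∩ {_u | (0 : ℝ) ≤ t})) ∩ Ioo (0 : ℝ) 1 =
      Ioc (0 : ℝ) (cdf μ t) \ {1} := by
    ext u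
    simp only [Set.mem_inter_iff, Set.mem_union, Set.mem_setOf_eq, Set.mem_compl_iff, Set.mem_Ioo, Set.mem_sdiff,
      Set.mem_Ioc, Set.mem_singleton_iff]
    have h1 := cdf_le_one μ t
    constructor
    · rintro ⟨h | h, hu⟩
      · exact ⟨⟨hu.1, h.2⟩, hu.2.ne⟩
      · exact (h.1 hu).elim
    · rintro ⟨⟨hu0, hut⟩, hu1⟩
      have hu1' : u < 1 := lt_of_le_of_ne (hut.trans h1) hu1
      exact ⟨Or.inl ⟨⟨hu0, hu1'⟩, hut⟩, hu0, hu1'⟩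
  rw [hset, measure_sdiff_null (measure_singleton _), Real.volume_Ioc, sub_zero, ofReal_cdf]

/-- `rqe` is measure preserving from `λ|_{(0,1)}` to `μ`. [folklore] -/
theorem measurePreserving_rqe (μ : Measure ℝ) [IsProbabilityMeasure μ] :
    MeasurePreserving (rqe μ) ((volume : Measure ℝ).restrict (Ioo (0 : ℝ) 1)) μ :=
  ⟨measurable_rqe μ, map_rqe_volume_restrict μ⟩

end Summit.CriticalPhenomena.PercolationContinuityZ3.Theorems.SahiAEFourFunctions
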